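import Literature.NumberTheory.EllipticCurves.PAdicLFunctionTameCongruenceProofs
import Literature.NumberTheory.EllipticCurves.PAdicLFunctionIntegralityAtTwoProofs
import HarnessLib

/-!
# `2`-integrality of the tame-level `2`-adic `L`-function `L₂(f, α, χ, T)` and Matsuno 2000, Lemma 3.2 AT `p = 2`
# in the tree's normalisation: `L₂(f, α, χ) ≡ L₂(f, α, 𝟙_m) (mod 2Λ)` for `E[2]` irreducible, `χ` even quadratic (PROOFS ONLY)

Cell bsd-2adic, seat conv-1 (planner RULING RC-159, road P3 — the ARITHMETIC of the scale). The scale-free analytic half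
is `norm_padicLCoeffTame_sub_le` (`PAdicLFunctionTameCongruenceProofs`): congruent characters give coefficients that differ
by at most `ε · sup ‖μ_{f,α,m}‖`. At `p = 2`, `χ = χ_d` quadratic, `χ' = 𝟙`, one has `ε = ‖2‖ = ½`; but the tame
Mazur–Swinnerton-Dyer measure of the newform of an `E[2]`-irreducible curve is only `½ℤ₂`-valued in the tree's
normalisation (periods `Ω⁺_f`: `[x]⁺_f ∈ (1/2n₀)ℤ`, `norm_ratPlusSymbol_two_le_two`), so the naive bound is `½ · 2 = 1`,
which is NOT a congruence. The missing factor is the `Δ = {±1}`-doubling of `PAdicLFunctionIntegralityAtTwoProofs` §3,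
here at tame level: the measure is EVEN, `μ_{f,α,m}((−a + 2ⁿℤ₂) × {−b}) = μ_{f,α,m}((a + 2ⁿℤ₂) × {b})` (§1,
`msdMeasureTame_neg`, any `p`), so for an EVEN character `χ` every Riemann sum of `L₂(f, α, χ, T)` is TWICE its `η = 1`
half (§2, `padicLRiemannSumTame_two_of_even`). Consequences (§3–§4), for `E = W/ℚ` good ordinary at `2`, `f` its
newform, `E[2]` irreducible (odd Eisenstein multiple from `not_irreducible_of_frobeniusTrace_congr_holds`, DDT Prop. 2.6(b)),
`m` prime to `2N`, `α` the unit root: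

* `norm_msdMeasureTame_two_le_two`: `‖μ_{f,α,m}((a + 2ⁿℤ₂) × {b})‖ ≤ 2` (tame fractions have denominator `2ⁿm`, prime to `N`);
* `norm_padicLCoeffTame_two_le_one`, `exists_iwasawaToPowerSeries_eq_padicLFunctionTame_two`: for every EVEN `ℚ₂`-valued
  `χ` mod `m`, `L₂(f, α, χ, T) ∈ ℤ₂⟦T⟧` (the tame companion of `padicLFunction_integral_two`);
* **`norm_padicLCoeffTame_sub_one_two_le`** (Matsuno 2000, Lemma 3.2 at `p = 2`, arithmetic form): for `χ` even with
  `χ² = 1`, `‖[T^k] L₂(f,α,χ) − [T^k] L₂(f,α,𝟙_m)‖ ≤ ‖2‖` for every `k`, i.e. `L₂(f,α,χ) ≡ L₂(f,α,𝟙_m) (mod 2ℤ₂⟦T⟧)`;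
  `exists_iwasawa_pair_map_toZMod_eq_two` writes it as an equality of reductions mod `2` of the two integral lifts
  (the currency of the cell's congruence `hcong`, `Summits/…/Theorems/TwoAdicConverseKidaAnalyticOfCongruence.lean`).

STATUS IN PRINT. Matsuno states Lemma 3.2 for his `G_{p,m}(E, φ, T)` (period lattice normalisation, `p`-power-order `ψ`);
at `p = 2` with a quadratic `ψ = χ_d` the congruence `ψ ≡ 1 (mod 2)` is the same remark, and the integrality of the
halved-symbol transform on the `E[2]`-irreducible locus is the mechanism of Greenberg–Vatsal Prop. 3.7 / Stevens plus the
`Δ`-doubling, exactly as in `PAdicLFunctionIntegralityAtTwoProofs` (level `1`). What is NOT done here: the Birch lemma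
identifying `L₂(f,α,χ_d)` with `L₂(f ⊗ χ_d, χ_d(2)α)` (road P4) and the Euler-factor bookkeeping over the primes of `d`
(`padicLCoeffTame_mul_prime`, landed).

## References

* K. Matsuno, *An analogue of Kida's formula for the p-adic L-functions of modular elliptic curves*, J. Number Theory 84
  (2000), 80–92, Lemma 3.2 (p. 87). [Matsuno2000]
* B. Mazur, J. Tate, J. Teitelbaum, *On p-adic analogues of the conjectures of Birch and Swinnerton-Dyer*, Invent. Math.
  84 (1986), §I.10–§I.13. [MazurTateTeitelbaum1986Invent]
* R. Greenberg, V. Vatsal, *On the Iwasawa invariants of elliptic curves*, Invent. Math. 142 (2000), Prop. 3.7 (mechanism).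
  [GreenbergVatsal2000]
* H. Darmon, F. Diamond, R. Taylor, *Fermat's Last Theorem* (1995), Prop. 2.6(b). [DarmonDiamondTaylor1995]
-/

noncomputable section

open scoped MatrixGroups ModularForm

open CongruenceSubgroup Filter Topology Literature.NumberTheory.EllipticCurves.ModularForms

namespace Literature.NumberTheory.EllipticCurves

/-! ### §1. The tame measure is even (any `p`) -/

section Evenness

variable {N : ℕ} [NeZero N] (f : CuspForm (Gamma0 N) 2) {p : ℕ} [Fact p.Prime] {m : ℕ} [NeZero m]

omit [NeZero m] in
/-- Chinese remainder: the representatives of the classes `(−a mod pⁿ, −b mod m)` and `(a mod pⁿ, b mod m)` add up to a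
multiple of `pⁿm` (both sums vanish mod `pⁿ` and mod `m`, `(m, p) = 1`); private helper. [folklore] -/
private theorem dvd_tameRep_neg_add [NeZero m] (hmp : m.Coprime p) (n : ℕ) (a : ZMod (p ^ n)) (b : ZMod m) :
    p ^ n * m ∣ tameRep p m n (-a) (-b) + tameRep p m n a b := by
  have hp : p.Prime := Fact.out
  have h1 : tameRep p m n (-a) (-b) + tameRep p m n a b ≡ 0 [MOD p ^ n] :=
    (ZMod.natCast_eq_natCast_iff _ _ _).mp (by
      rw [Nat.cast_add, natCast_tameRep_left hp hmp, natCast_tameRep_left hp hmp, neg_add_cancel,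
        Nat.cast_zero])
  have h2 : tameRep p m n (-a) (-b) + tameRep p m n a b ≡ 0 [MOD m] :=
    (ZMod.natCast_eq_natCast_iff _ _ _).mp (by
      rw [Nat.cast_add, natCast_tameRep_right hmp, natCast_tameRep_right hmp, neg_add_cancel, Nat.cast_zero])
  exact (Nat.modEq_zero_iff_dvd.mp ((Nat.modEq_and_modEq_iff_modEq_mul (hmp.symm.pow_left n)).mp ⟨h1, h2⟩))

/-- The tame fraction of `(−a, −b)` is MINUS that of `(a, b)` up to an integer: `c₋/(pⁿm) = −c/(pⁿm) + z`, `z ∈ ℤ`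
(`dvd_tameRep_neg_add`); private helper. [folklore] -/
private theorem exists_tameFraction_neg_eq (hmp : m.Coprime p) (n : ℕ) (a : ZMod (p ^ n)) (b : ZMod m) :
    ∃ z : ℤ, tameFraction p m n (-a) (-b) = -tameFraction p m n a b + z := by
  have hp : p.Prime := Fact.out
  obtain ⟨z, hz⟩ := dvd_tameRep_neg_add hmp n a b
  refine ⟨z, ?_⟩
  have hD : ((p : ℚ) ^ n * m) ≠ 0 :=
    mul_ne_zero (pow_ne_zero _ (by exact_mod_cast hp.ne_zero)) (by exact_mod_cast NeZero.ne m)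
  have hz' : (tameRep p m n (-a) (-b) : ℚ) = (p : ℚ) ^ n * m * z - tameRep p m n a b := by
    have h := congrArg (Nat.cast : ℕ → ℚ) hz
    push_cast at h
    linear_combination h
  unfold tameFraction
  rw [hz', sub_div, mul_div_cancel_left₀ _ hD]
  push_cast
  ring

/-- **The tame Mazur–Swinnerton-Dyer measure is even**: `μ_{f,α,m}((−a + pⁿℤ_p) × {−b}) = μ_{f,α,m}((a + pⁿℤ_p) × {b})`
(`(m, p) = 1`), by `[−r]⁺_f = [r]⁺_f` (`ratPlusSymbol_neg`, Mazur–Tate–Teitelbaum §I.8) and translation invariance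
`[r + z]⁺_f = [r]⁺_f` (`ratPlusSymbol_add_intCast_eq`), the fraction of `(−a, −b)` being `−c/(pⁿm) + z`; the tame companion of
`msdMeasure_neg`. [cite: MazurTateTeitelbaum1986Invent, §I.8 and §I.10 (10.1) (pp. 10–13)] -/
theorem msdMeasureTame_neg (hmp : m.Coprime p) (α : ℚ_[p]) (n : ℕ) (a : ZMod (p ^ n)) (b : ZMod m) :
    msdMeasureTame f m α n (-a) (-b) = msdMeasureTame f m α n a b := by
  obtain ⟨z, hz⟩ := exists_tameFraction_neg_eq hmp n a b
  have h1 : ratPlusSymbol f (tameFraction p m n (-a) (-b)) = ratPlusSymbol f (tameFraction p m n a b) := by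
    rw [hz, ratPlusSymbol_add_intCast_eq, ratPlusSymbol_neg]
  have h2 : ratPlusSymbol f ((p : ℚ) * tameFraction p m n (-a) (-b)) =
      ratPlusSymbol f ((p : ℚ) * tameFraction p m n a b) := by
    have e : (p : ℚ) * tameFraction p m n (-a) (-b) =
        -((p : ℚ) * tameFraction p m n a b) + (((p : ℤ) * z : ℤ) : ℚ) := by
      rw [hz]; push_cast; ring
    rw [e, ratPlusSymbol_add_intCast_eq, ratPlusSymbol_neg]
  simp only [msdMeasureTame, h1, h2]

end Evenness

/-! ### §2. The `Δ = {±1}` doubling of the tame Riemann sums at `p = 2` (even characters) -/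

section Two

variable {N : ℕ} [NeZero N] (f : CuspForm (Gamma0 N) 2) {m : ℕ} [NeZero m]

/-- The `2`-adic roots of unity of order dividing `2` are `±1`; private helper (as in the level-`1` file). [folklore] -/
private theorem coe_rootsOfUnity_two_eq_one_or (ξ : rootsOfUnity 2 ℤ_[2]) :
    ((ξ : ℤ_[2]ˣ) : ℤ_[2]) = 1 ∨ ((ξ : ℤ_[2]ˣ) : ℤ_[2]) = -1 := by
  have h := ξ.2
  rw [mem_rootsOfUnity] at h
  have h' : (((ξ : ℤ_[2]ˣ) : ℤ_[2])) ^ 2 = 1 := by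
    rw [← Units.val_pow_eq_pow_val, h, Units.val_one]
  exact sq_eq_one_iff.mp h'

/-- **The `Δ`-doubling at `p = 2`, tame level, EVEN character**: every Riemann sum of `L₂(f, α, χ, T)` is TWICE its
`η = 1` half, `padicLRiemannSumTame f m α χ k n = 2 · Σ_{s mod 2ⁿ} Σ_{b mod m} χ(b) μ_{f,α,m}((5ˢ + 2ⁿ⁺²ℤ₂) × {b}) · C(s,k)`:
the torsion of `ℤ₂^×` is `{±1}` (`torsionOrder_two`), and the `η = −1` half equals the `η = 1` half after `b ↦ −b`
by evenness of the measure (`msdMeasureTame_neg`) and of `χ` (`χ(−b) = χ(−1)χ(b) = χ(b)`). For `m = 1`, `χ = 1`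
this is `padicLRiemannSum_two`. [cite: MazurTateTeitelbaum1986Invent, §I.13 (pp. 18–19; p = 2: Δ = {±1}, γ = 5)] -/
theorem padicLRiemannSumTame_two_of_even (hm2 : m.Coprime 2) (α : ℚ_[2]) (χ : DirichletCharacter ℚ_[2] m)
    (hχ : χ.Even) (k n : ℕ) :
    padicLRiemannSumTame f m α χ k n =
      2 * ∑ s : ZMod (2 ^ n), ∑ b : ZMod m,
        χ b * msdMeasureTame f m α (n + 2) ((cyclotomicGenerator 2 : ZMod (2 ^ (n + 2))) ^ s.val) b *
          (s.val.choose k : ℚ_[2]) := by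
  classical
  have hχ' : χ (-1) = 1 := hχ
  -- the summand as a function of the Teichmüller representative
  set G : ℤ_[2] → ℚ_[2] := fun u ↦ ∑ s : ZMod (2 ^ n), ∑ b : ZMod m,
    χ b * msdMeasureTame f m α (n + 2) (PadicInt.toZModPow (n + 2) u *
        (cyclotomicGenerator 2 : ZMod (2 ^ (n + 2))) ^ s.val) b * (s.val.choose k : ℚ_[2]) with hG
  have hG1 : G 1 = ∑ s : ZMod (2 ^ n), ∑ b : ZMod m,
      χ b * msdMeasureTame f m α (n + 2) ((cyclotomicGenerator 2 : ZMod (2 ^ (n + 2))) ^ s.val) b *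
        (s.val.choose k : ℚ_[2]) := by
    simp only [hG, map_one, one_mul]
  have hGneg : G (-1) = G 1 := by
    simp only [hG, map_neg, map_one, neg_one_mul, one_mul]
    refine Finset.sum_congr rfl fun s _ ↦ ?_
    refine Fintype.sum_equiv (Equiv.neg (ZMod m)) _ _ fun b ↦ ?_
    rw [Equiv.neg_apply, show χ (-b) = χ b by rw [← neg_one_mul, map_mul, hχ', one_mul],
      ← msdMeasureTame_neg f hm2 α (n + 2) _ (-b), neg_neg]
  -- the torsion group at `2` is `{1, ζ}` with `ζ = -1`
  have hζmem : (-1 : ℤ_[2]ˣ) ∈ rootsOfUnity 2 ℤ_[2] := by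
    rw [mem_rootsOfUnity]; norm_num
  set ζ : rootsOfUnity 2 ℤ_[2] := ⟨-1, hζmem⟩ with hζ
  have hne : (1 : rootsOfUnity 2 ℤ_[2]) ≠ ζ := by
    intro h
    have h' : (((1 : rootsOfUnity 2 ℤ_[2]) : ℤ_[2]ˣ) : ℤ_[2]) = ((ζ : ℤ_[2]ˣ) : ℤ_[2]) := by
      rw [h]
    rw [hζ] at h'
    simp only [OneMemClass.coe_one, Units.val_one, Units.val_neg] at h'
    have h2 : (2 : ℤ_[2]) = 0 := by linear_combination h'
    exact two_ne_zero h2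
  haveI : Fintype (rootsOfUnity 2 ℤ_[2]) := Fintype.ofFinite _
  have huniv : (Finset.univ : Finset (rootsOfUnity 2 ℤ_[2])) = {1, ζ} := by
    ext ξ
    simp only [Finset.mem_univ, Finset.mem_insert, Finset.mem_singleton, true_iff]
    rcases coe_rootsOfUnity_two_eq_one_or ξ with h | h
    · left
      exact Subtype.ext (Units.ext (by simpa using h))
    · right
      exact Subtype.ext (Units.ext (by rw [hζ]; simpa using h))
  -- unfold the Riemann sum at `p = 2`
  have hRS : padicLRiemannSumTame f m α χ k n =
      ∑ᶠ ξ : rootsOfUnity (torsionOrder 2) ℤ_[2], G ((ξ : ℤ_[2]ˣ) : ℤ_[2]) := by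
    rw [padicLRiemannSumTame]
    rfl
  rw [hRS, torsionOrder_two, finsum_eq_sum_of_fintype, huniv, Finset.sum_pair hne]
  simp only [OneMemClass.coe_one, Units.val_one, hζ, Units.val_neg]
  rw [hGneg, hG1, two_mul]

/-- A value of a `ℚ_p`-valued Dirichlet character has norm `≤ 1` (it is `0` or a root of unity); private helper. [folklore] -/
private theorem norm_dirichletCharacter_apply_le_one {p : ℕ} [Fact p.Prime] (χ : DirichletCharacter ℚ_[p] m)
    (b : ZMod m) : ‖χ b‖ ≤ 1 := by
  by_cases hb : IsUnit b
  · obtain ⟨u, rfl⟩ := hb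
    have hfin : IsOfFinOrder (χ.toUnitHom u) := MonoidHom.isOfFinOrder _ (isOfFinOrder_of_finite u)
    obtain ⟨k, hk, hpow⟩ := hfin.exists_pow_eq_one
    have hval : (χ (u : ZMod m)) ^ k = 1 := by
      have := congr_arg (fun x : ℚ_[p]ˣ ↦ (x : ℚ_[p])) hpow
      simpa [MulChar.coe_toUnitHom] using this
    have hn : ‖χ (u : ZMod m)‖ ^ k = 1 := by rw [← norm_pow, hval, norm_one]
    exact (pow_eq_one_iff_of_nonneg (norm_nonneg _) hk.ne').mp hn |>.le
  · rw [χ.map_nonunit hb, norm_zero]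
    exact zero_le_one

/-- **Riemann sums of an even character gain a factor `‖2‖`**: if `‖μ_{f,α,m}‖ ≤ C` then
`‖padicLRiemannSumTame f m α χ k n‖ ≤ ‖2‖ · C` for `χ` even (doubling, `‖χ(b)‖ ≤ 1`, `‖C(s,k)‖ ≤ 1`, ultrametric).
[cite: MazurTateTeitelbaum1986Invent, §I.13 (pp. 18–19; p = 2: Δ = {±1}, γ = 5)] -/
theorem norm_padicLRiemannSumTame_two_le (hm2 : m.Coprime 2) (α : ℚ_[2]) (χ : DirichletCharacter ℚ_[2] m)
    (hχ : χ.Even) {C : ℝ} (hC0 : 0 ≤ C)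
    (hC : ∀ (n : ℕ) (a : ZMod (2 ^ n)) (b : ZMod m), ‖msdMeasureTame f m α n a b‖ ≤ C) (k n : ℕ) :
    ‖padicLRiemannSumTame f m α χ k n‖ ≤ ‖(2 : ℚ_[2])‖ * C := by
  rw [padicLRiemannSumTame_two_of_even f hm2 α χ hχ, norm_mul]
  gcongr
  refine IsUltrametricDist.norm_sum_le_of_forall_le_of_nonneg hC0 fun s _ ↦ ?_
  refine IsUltrametricDist.norm_sum_le_of_forall_le_of_nonneg hC0 fun b _ ↦ ?_
  have hc : ‖((s.val.choose k : ℕ) : ℚ_[2])‖ ≤ 1 := by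
    have h := Padic.norm_int_le_one (p := 2) ((s.val.choose k : ℕ) : ℤ)
    rwa [Int.cast_natCast] at h
  rw [norm_mul, norm_mul]
  calc ‖χ b‖ * ‖msdMeasureTame f m α (n + 2) ((cyclotomicGenerator 2 : ZMod (2 ^ (n + 2))) ^ s.val) b‖ *
        ‖((s.val.choose k : ℕ) : ℚ_[2])‖ ≤ 1 * C * 1 :=
        mul_le_mul (mul_le_mul (norm_dirichletCharacter_apply_le_one χ b) (hC _ _ _) (norm_nonneg _)
          zero_le_one) hc (norm_nonneg _) (by positivity)
    _ = C := by ring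

/-- **Termwise congruence with the doubling** (Matsuno 2000, proof of Lemma 3.2, at `p = 2`): for `χ`, `χ'` EVEN with
`‖χ(b) − χ'(b)‖ ≤ ε` and `‖μ_{f,α,m}‖ ≤ C`, the Riemann sums of `L₂(f,α,χ)` and `L₂(f,α,χ')` differ by at most `‖2‖ · ε · C`
(one factor `‖2‖` better than `norm_padicLRiemannSumTame_sub_le`). [cite: Matsuno2000, Lemma 3.2 (p. 87), proof] -/
theorem norm_padicLRiemannSumTame_sub_two_le (hm2 : m.Coprime 2) (α : ℚ_[2]) (χ χ' : DirichletCharacter ℚ_[2] m)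
    (hχ : χ.Even) (hχ' : χ'.Even) {ε : ℝ} (hε : 0 ≤ ε) (hχχ' : ∀ b : ZMod m, ‖χ b - χ' b‖ ≤ ε) {C : ℝ}
    (hC0 : 0 ≤ C) (hC : ∀ (n : ℕ) (a : ZMod (2 ^ n)) (b : ZMod m), ‖msdMeasureTame f m α n a b‖ ≤ C)
    (k n : ℕ) :
    ‖padicLRiemannSumTame f m α χ k n - padicLRiemannSumTame f m α χ' k n‖ ≤ ‖(2 : ℚ_[2])‖ * (ε * C) := by
  rw [padicLRiemannSumTame_two_of_even f hm2 α χ hχ, padicLRiemannSumTame_two_of_even f hm2 α χ' hχ', ← mul_sub,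
    norm_mul, ← Finset.sum_sub_distrib]
  gcongr
  refine IsUltrametricDist.norm_sum_le_of_forall_le_of_nonneg (by positivity) fun s _ ↦ ?_
  rw [← Finset.sum_sub_distrib]
  refine IsUltrametricDist.norm_sum_le_of_forall_le_of_nonneg (by positivity) fun b _ ↦ ?_
  have hc : ‖((s.val.choose k : ℕ) : ℚ_[2])‖ ≤ 1 := by
    have h := Padic.norm_int_le_one (p := 2) ((s.val.choose k : ℕ) : ℤ)
    rwa [Int.cast_natCast] at h
  rw [← sub_mul, ← sub_mul, norm_mul, norm_mul]
  calc ‖χ b - χ' b‖ * ‖msdMeasureTame f m α (n + 2) ((cyclotomicGenerator 2 : ZMod (2 ^ (n + 2))) ^ s.val) b‖ *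
        ‖((s.val.choose k : ℕ) : ℚ_[2])‖ ≤ ε * C * 1 :=
        mul_le_mul (mul_le_mul (hχχ' b) (hC _ _ _) (norm_nonneg _) hε) hc (norm_nonneg _) (by positivity)
    _ = ε * C := mul_one _

omit [NeZero m] in
/-- The trivial character mod `m` is even: `𝟙_m(−1) = 1` (`−1` is a unit); private helper. [folklore] -/
private theorem even_one_dirichletCharacter {R : Type*} [CommRing R] : (1 : DirichletCharacter R m).Even := by
  show (1 : DirichletCharacter R m) (-1) = 1
  rw [show (-1 : ZMod m) = (((-1 : (ZMod m)ˣ) : (ZMod m)ˣ) : ZMod m) by simp, MulChar.one_apply_coe]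

end Two

/-! ### §3. `μ_{f,α,m}` is `½ℤ₂`-valued at `2` on the `E[2]`-irreducible locus -/

section Assembly

variable {N : ℕ} [NeZero N] {f : CuspForm (Gamma0 N) 2} {m : ℕ} [NeZero m]
  {W : WeierstrassCurve ℚ} [W.IsElliptic] [W.IsGloballyMinimal]

omit [NeZero N] [NeZero m] in
/-- The denominator of `j · c/(2ⁿm)` is prime to `N` when `2 ∤ N` and `(m, N) = 1` (it divides `2ⁿm`); private helper. [folklore] -/
private theorem coprime_den_mul_tameFraction_two (hpN : ¬ 2 ∣ N) (hmN : m.Coprime N) (n : ℕ) (a : ZMod (2 ^ n))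
    (b : ZMod m) (j : ℕ) : Nat.Coprime ((j : ℚ) * tameFraction 2 m n a b).den N := by
  have hcop : Nat.Coprime (2 ^ n * m) N :=
    Nat.Coprime.mul_left (Nat.Coprime.pow_left n ((Nat.Prime.coprime_iff_not_dvd Nat.prime_two).mpr hpN)) hmN
  have h := coprime_den_of_coprime hcop ((j * tameRep 2 m n a b : ℕ) : ℤ)
  have e : (j : ℚ) * tameFraction 2 m n a b =
      (((j * tameRep 2 m n a b : ℕ) : ℤ) : ℚ) / ((2 ^ n * m : ℕ) : ℚ) := by
    unfold tameFraction; push_cast; ring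
  rwa [e]

omit [NeZero m] in
/-- **`‖[j · c/(2ⁿm)]⁺_f‖₂ ≤ 2`** at the tame fractions, for a real-coefficient `f` with an ODD Eisenstein multiple
`n₀ {∞,0}_f ∈ Λ_f`, `2 ∤ N`, `(m, N) = 1` (`norm_ratPlusSymbol_two_le_two`: `[x]⁺_f = k/(2n₀)` at cusps of denominator prime
to `N`). [cite: CremonaAlgorithms1997, §2.8] -/
theorem norm_ratPlusSymbol_tameFraction_two_le_two (hreal : ∀ n, (cuspCoeff f n).im = 0) {n₀ : ℤ}
    (h2n₀ : ¬ (2 : ℤ) ∣ n₀) (h0 : (n₀ : ℂ) * modularSymbol f 0 ∈ periodLattice f) (hpN : ¬ 2 ∣ N)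
    (hmN : m.Coprime N) (n : ℕ) (a : ZMod (2 ^ n)) (b : ZMod m) (j : ℕ) :
    ‖((ratPlusSymbol f ((j : ℚ) * tameFraction 2 m n a b) : ℚ) : ℚ_[2])‖ ≤ 2 :=
  norm_ratPlusSymbol_two_le_two f hreal h2n₀ h0 (coprime_den_mul_tameFraction_two hpN hmN n a b j)

omit [NeZero m] in
/-- **`‖μ_{f,α,m}((a + 2ⁿℤ₂) × {b})‖ ≤ 2`** for the unit root `α` at a good ordinary `2`, `f` the newform of `E = W`
(real coefficients, `2 ∤ N`), `(m, N) = 1`, given an ODD Eisenstein multiple `n₀ {∞,0}_f ∈ Λ_f`: both symbols in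
MTT (10.1) have norm `≤ 2` and `‖α⁻¹‖ = 1`; the tame companion of `norm_msdMeasure_two_le_two`.
[cite: MazurTateTeitelbaum1986Invent, §I.10 (10.1) (pp. 12–13)] -/
theorem norm_msdMeasureTame_two_le_two (hord : IsOrdinaryAt W 2) (hf : IsNewformOf W f) {n₀ : ℤ}
    (h2n₀ : ¬ (2 : ℤ) ∣ n₀) (h0 : (n₀ : ℂ) * modularSymbol f 0 ∈ periodLattice f) (hmN : m.Coprime N)
    (n : ℕ) (a : ZMod (2 ^ n)) (b : ZMod m) :
    ‖msdMeasureTame f m (unitRoot W 2 : ℚ_[2]) n a b‖ ≤ 2 := by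
  have hpN : ¬ 2 ∣ N := not_dvd_level_of_isNewformOf hf hord.1
  have hreal : ∀ n, (cuspCoeff f n).im = 0 :=
    cuspCoeff_im_eq_zero_of_coeffField_eq_bot hf.coeffField_eq_bot
  set α : ℚ_[2] := (unitRoot W 2 : ℚ_[2]) with hα
  have hαu : ‖α‖ = 1 := (unitRoot_coe_spec (W := W) hord).2.1
  have hαi : ‖α⁻¹‖ = 1 := by rw [norm_inv, hαu, inv_one]
  have hA : ‖α⁻¹ ^ n * ((ratPlusSymbol f (tameFraction 2 m n a b) : ℚ) : ℚ_[2])‖ ≤ 2 := by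
    rw [norm_mul, norm_pow, hαi, one_pow, one_mul]
    have h := norm_ratPlusSymbol_tameFraction_two_le_two hreal h2n₀ h0 hpN hmN n a b 1
    rwa [Nat.cast_one, one_mul] at h
  have hB : ‖α⁻¹ ^ (n + 1) * ((ratPlusSymbol f ((2 : ℚ) * tameFraction 2 m n a b) : ℚ) : ℚ_[2])‖ ≤ 2 := by
    rw [norm_mul, norm_pow, hαi, one_pow, one_mul]
    have h := norm_ratPlusSymbol_tameFraction_two_le_two hreal h2n₀ h0 hpN hmN n a b 2
    rwa [Nat.cast_ofNat] at h
  have hcast : ((2 : ℕ) : ℚ) = (2 : ℚ) := by norm_num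
  unfold msdMeasureTame
  rw [hcast, sub_eq_add_neg]
  refine (Padic.nonarchimedean _ _).trans (max_le hA ?_)
  rw [norm_neg]
  exact hB

/-! ### §4. Integrality of `L₂(f, α, χ, T)` and the congruence `L₂(f,α,χ) ≡ L₂(f,α,𝟙_m) (mod 2)` -/

/-- Convergence of the tame Riemann sums for the newform of `E = W` and its unit root at a good ordinary `2`
(`tendsto_padicLRiemannSumTame_holds` with the glue `IsNewformOf ⇒ IsNewform0, coeffField = ⊥, a₂(f) = a₂(E)`,
`unitRoot_coe_spec`). [cite: MazurTateTeitelbaum1986Invent, §I.11–I.13 (pp. 13–19)] -/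
theorem tendsto_padicLRiemannSumTame_unitRoot_two (hord : IsOrdinaryAt W 2) (hf : IsNewformOf W f)
    (hm2 : m.Coprime 2) (χ : DirichletCharacter ℚ_[2] m) (k : ℕ) :
    Tendsto (padicLRiemannSumTame f m (unitRoot W 2 : ℚ_[2]) χ k) atTop
      (𝓝 (padicLCoeffTame f m (unitRoot W 2 : ℚ_[2]) χ k)) := by
  obtain ⟨hαeq, hαu, -⟩ := unitRoot_coe_spec (W := W) hord
  exact tendsto_padicLRiemannSumTame_holds hf.1 hf.coeffField_eq_bot (not_dvd_level_of_isNewformOf hf hord.1)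
    hm2 (cuspCoeff_eq_frobeniusTrace_of_isNewformOf_holds hf hord.1) hαeq hαu χ k

/-- **`2`-integrality of `L₂(f, α, χ, T)` from one odd Eisenstein multiple**, `χ` EVEN: every coefficient has
`‖·‖₂ ≤ 1` — each Riemann sum is `2 × (terms of norm ≤ 2)` (`norm_padicLRiemannSumTame_two_le` with
`norm_msdMeasureTame_two_le_two`), so of norm `≤ ‖2‖ · 2 = 1`, the sums converge and the unit ball is closed.
[cite: MazurTateTeitelbaum1986Invent, §I.10–§I.13 (pp. 12–19)] -/
theorem norm_padicLCoeffTame_two_le_one_of_oddMultiple (hord : IsOrdinaryAt W 2) (hf : IsNewformOf W f)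
    {n₀ : ℤ} (h2n₀ : ¬ (2 : ℤ) ∣ n₀) (h0 : (n₀ : ℂ) * modularSymbol f 0 ∈ periodLattice f) (hm2 : m.Coprime 2)
    (hmN : m.Coprime N) (χ : DirichletCharacter ℚ_[2] m) (hχ : χ.Even) (k : ℕ) :
    ‖padicLCoeffTame f m (unitRoot W 2 : ℚ_[2]) χ k‖ ≤ 1 := by
  have hμ := norm_msdMeasureTame_two_le_two (m := m) hord hf h2n₀ h0 hmN
  have h2 : ‖(2 : ℚ_[2])‖ = (2 : ℝ)⁻¹ := by
    have h := Padic.norm_p (p := 2)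
    simpa using h
  have hRS : ∀ n, ‖padicLRiemannSumTame f m (unitRoot W 2 : ℚ_[2]) χ k n‖ ≤ 1 := by
    intro n
    have h := norm_padicLRiemannSumTame_two_le f hm2 _ χ hχ zero_le_two hμ k n
    rw [h2] at h
    linarith
  exact le_of_tendsto (tendsto_padicLRiemannSumTame_unitRoot_two hord hf hm2 χ k).norm
    (Eventually.of_forall hRS)

/-- **Integrality of the tame `2`-adic `L`-function when `E[2]` is irreducible (UNCONDITIONAL)**: for `E = W/ℚ`
globally minimal, good ordinary at `2`, `f` its newform, `ρ̄_{E,2}` irreducible, `m` prime to `2N` and `χ` an EVEN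
`ℚ₂`-valued Dirichlet character mod `m`, every coefficient of `L₂(f, α, χ, T)` (`α` the unit root) lies in `ℤ₂`. The
arithmetic input is `not_irreducible_of_frobeniusTrace_congr_holds` (DDT Prop. 2.6(b)) via
`exists_intCast_mul_modularSymbol_zero_mem`; the tame companion of `padicLFunction_integral_two`.
[cite: GreenbergVatsal2000, Prop. 3.7 (mechanism; odd p in print)] [cite: DarmonDiamondTaylor1995, Prop. 2.6(b)] -/
theorem norm_padicLCoeffTame_two_le_one (hord : IsOrdinaryAt W 2) (hf : IsNewformOf W f)
    (hirr : W.HasIrreducibleModPGaloisRep 2) (hm2 : m.Coprime 2) (hmN : m.Coprime N)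
    (χ : DirichletCharacter ℚ_[2] m) (hχ : χ.Even) (k : ℕ) :
    ‖padicLCoeffTame f m (unitRoot W 2 : ℚ_[2]) χ k‖ ≤ 1 := by
  obtain ⟨n₀, h2n₀, h0⟩ := exists_intCast_mul_modularSymbol_zero_mem (p := 2)
    not_irreducible_of_frobeniusTrace_congr_holds hf hirr
  exact norm_padicLCoeffTame_two_le_one_of_oddMultiple hord hf h2n₀ h0 hm2 hmN χ hχ k

/-- **`L₂(f, α, χ, T) ∈ Λ = ℤ₂⟦T⟧`** under the hypotheses of `norm_padicLCoeffTame_two_le_one`: there is `G ∈ ℤ₂⟦T⟧` with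
`ι G = padicLFunctionTame f m α χ` (coefficientwise criterion `exists_iwasawaToPowerSeries_eq_iff_norm_coeff_le_one`).
[cite: MazurTateTeitelbaum1986Invent, §I.12 (p. 17)] -/
theorem exists_iwasawaToPowerSeries_eq_padicLFunctionTame_two (hord : IsOrdinaryAt W 2) (hf : IsNewformOf W f)
    (hirr : W.HasIrreducibleModPGaloisRep 2) (hm2 : m.Coprime 2) (hmN : m.Coprime N)
    (χ : DirichletCharacter ℚ_[2] m) (hχ : χ.Even) :
    ∃ G : IwasawaAlgebra 2,
      iwasawaToPowerSeries 2 G = padicLFunctionTame f m (unitRoot W 2 : ℚ_[2]) χ :=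
  (exists_iwasawaToPowerSeries_eq_iff_norm_coeff_le_one _).mpr fun k ↦ by
    rw [coeff_padicLFunctionTame]
    exact norm_padicLCoeffTame_two_le_one hord hf hirr hm2 hmN χ hχ k

/-- **Matsuno 2000, Lemma 3.2 at `p = 2` in the tree's normalisation, from one odd Eisenstein multiple**: for `χ` even
and quadratic (`χ² = 1`) mod `m`, `(m, 2N) = 1`, `‖[T^k] L₂(f,α,χ) − [T^k] L₂(f,α,𝟙_m)‖ ≤ ‖2‖`: `ε = ‖2‖`
(`norm_sub_one_apply_le_of_sq_eq_one`), `C = 2` (`norm_msdMeasureTame_two_le_two`) and the doubling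
(`norm_padicLRiemannSumTame_sub_two_le`): `‖2‖ · ‖2‖ · 2 = ‖2‖`. [cite: Matsuno2000, Lemma 3.2 (p. 87)] -/
theorem norm_padicLCoeffTame_sub_one_two_le_of_oddMultiple (hord : IsOrdinaryAt W 2) (hf : IsNewformOf W f)
    {n₀ : ℤ} (h2n₀ : ¬ (2 : ℤ) ∣ n₀) (h0 : (n₀ : ℂ) * modularSymbol f 0 ∈ periodLattice f) (hm2 : m.Coprime 2)
    (hmN : m.Coprime N) (χ : DirichletCharacter ℚ_[2] m) (hχ : χ.Even) (hsq : χ ^ 2 = 1) (k : ℕ) :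
    ‖padicLCoeffTame f m (unitRoot W 2 : ℚ_[2]) χ k -
        padicLCoeffTame f m (unitRoot W 2 : ℚ_[2]) (1 : DirichletCharacter ℚ_[2] m) k‖ ≤ ‖(2 : ℚ_[2])‖ := by
  have hμ := norm_msdMeasureTame_two_le_two (m := m) hord hf h2n₀ h0 hmN
  have h2 : ‖(2 : ℚ_[2])‖ = (2 : ℝ)⁻¹ := by
    have h := Padic.norm_p (p := 2)
    simpa using h
  have hRS : ∀ n, ‖padicLRiemannSumTame f m (unitRoot W 2 : ℚ_[2]) χ k n -
      padicLRiemannSumTame f m (unitRoot W 2 : ℚ_[2]) (1 : DirichletCharacter ℚ_[2] m) k n‖ ≤ ‖(2 : ℚ_[2])‖ := by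
    intro n
    have h := norm_padicLRiemannSumTame_sub_two_le f hm2 _ χ 1 hχ even_one_dirichletCharacter (norm_nonneg _)
      (norm_sub_one_apply_le_of_sq_eq_one χ hsq) zero_le_two hμ k n
    rw [h2] at h ⊢
    linarith
  exact le_of_tendsto ((tendsto_padicLRiemannSumTame_unitRoot_two hord hf hm2 χ k).sub
    (tendsto_padicLRiemannSumTame_unitRoot_two hord hf hm2 1 k)).norm (Eventually.of_forall hRS)

/-- **Matsuno 2000, Lemma 3.2 at `p = 2`, `E[2]` irreducible (UNCONDITIONAL, tree normalisation).** For `E = W/ℚ`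
globally minimal, good ordinary at `2`, `f` its newform, `ρ̄_{E,2}` irreducible, `m` prime to `2N`, and `χ` an even
quadratic `ℚ₂`-valued Dirichlet character mod `m` (e.g. `χ_d`, `d > 0`): for every `k`,
`‖[T^k] L₂(f,α,χ) − [T^k] L₂(f,α,𝟙_m)‖₂ ≤ ‖2‖₂`, i.e. `L₂(f,α,χ,T) ≡ L₂(f,α,𝟙_m,T) (mod 2ℤ₂⟦T⟧)` — Matsuno's
"`G_{p,m}(E, φψ, T) ≡ G_{p,m}(E, φ, T) (mod π)`" with `φ = 1`, `ψ = χ`, `π = 2`, for the tree's halved-symbol transform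
(integral here by the `Δ`-doubling). [cite: Matsuno2000, Lemma 3.2 (p. 87)] [cite: DarmonDiamondTaylor1995, Prop. 2.6(b)] -/
theorem norm_padicLCoeffTame_sub_one_two_le (hord : IsOrdinaryAt W 2) (hf : IsNewformOf W f)
    (hirr : W.HasIrreducibleModPGaloisRep 2) (hm2 : m.Coprime 2) (hmN : m.Coprime N)
    (χ : DirichletCharacter ℚ_[2] m) (hχ : χ.Even) (hsq : χ ^ 2 = 1) (k : ℕ) :
    ‖padicLCoeffTame f m (unitRoot W 2 : ℚ_[2]) χ k -
        padicLCoeffTame f m (unitRoot W 2 : ℚ_[2]) (1 : DirichletCharacter ℚ_[2] m) k‖ ≤ ‖(2 : ℚ_[2])‖ := by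
  obtain ⟨n₀, h2n₀, h0⟩ := exists_intCast_mul_modularSymbol_zero_mem (p := 2)
    not_irreducible_of_frobeniusTrace_congr_holds hf hirr
  exact norm_padicLCoeffTame_sub_one_two_le_of_oddMultiple hord hf h2n₀ h0 hm2 hmN χ hχ hsq k

end Assembly

/-! ### §5. The congruence as an equality of reductions mod `p` of integral lifts -/

section Lift

variable {p : ℕ} [Fact p.Prime]

/-- **Integral power series congruent coefficientwise modulo `p` have equal reductions**: if `L, L' ∈ ℚ_p⟦T⟧` have
coefficients of norm `≤ 1` and `‖[T^k](L − L')‖ < 1` for all `k`, there are `G, G' ∈ Λ = ℤ_p⟦T⟧` with `ι G = L`, `ι G' = L'`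
and `G mod p = G' mod p` in `𝔽_p⟦T⟧` (`ℤ_p ↪ ℚ_p` coefficientwise; `ker (ℤ_p → 𝔽_p) = {‖·‖ < 1}`, `PadicInt.ker_toZMod`).
[cite: MazurTateTeitelbaum1986Invent, §I.12 (p. 17)] -/
theorem exists_iwasawa_pair_map_toZMod_eq (L L' : PowerSeries ℚ_[p]) (hL : ∀ k, ‖PowerSeries.coeff k L‖ ≤ 1)
    (hL' : ∀ k, ‖PowerSeries.coeff k L'‖ ≤ 1)
    (hsub : ∀ k, ‖PowerSeries.coeff k L - PowerSeries.coeff k L'‖ < 1) :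
    ∃ G G' : IwasawaAlgebra p, iwasawaToPowerSeries p G = L ∧ iwasawaToPowerSeries p G' = L' ∧
      PowerSeries.map (PadicInt.toZMod (p := p)) G = PowerSeries.map (PadicInt.toZMod (p := p)) G' := by
  refine ⟨PowerSeries.mk fun k ↦ ⟨PowerSeries.coeff k L, hL k⟩,
    PowerSeries.mk fun k ↦ ⟨PowerSeries.coeff k L', hL' k⟩, ?_, ?_, ?_⟩
  · ext k
    simp [PowerSeries.coeff_map]
  · ext k
    simp [PowerSeries.coeff_map]
  · ext k
    rw [PowerSeries.coeff_map, PowerSeries.coeff_map, PowerSeries.coeff_mk, PowerSeries.coeff_mk, ← sub_eq_zero,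
      ← map_sub, ← RingHom.mem_ker, PadicInt.ker_toZMod, IsLocalRing.mem_maximalIdeal, mem_nonunits_iff,
      PadicInt.isUnit_iff, PadicInt.norm_def, PadicInt.coe_sub]
    exact (hsub k).ne

variable {N : ℕ} [NeZero N] {f : CuspForm (Gamma0 N) 2} {m : ℕ} [NeZero m]
  {W : WeierstrassCurve ℚ} [W.IsElliptic] [W.IsGloballyMinimal]

/-- **`L₂(f,α,χ) ≡ L₂(f,α,𝟙_m) (mod 2Λ)` as reductions of integral lifts** (Matsuno 2000, Lemma 3.2 at `p = 2`, in the
currency of the cell's congruence `hcong`): under the hypotheses of `norm_padicLCoeffTame_sub_one_two_le` there are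
`G, G₁ ∈ ℤ₂⟦T⟧` with `ι G = L₂(f,α,χ,T)`, `ι G₁ = L₂(f,α,𝟙_m,T)` and `G mod 2 = G₁ mod 2` in `𝔽₂⟦T⟧`.
[cite: Matsuno2000, Lemma 3.2 (p. 87)] [cite: MazurTateTeitelbaum1986Invent, §I.12 (p. 17)] -/
theorem exists_iwasawa_pair_map_toZMod_eq_two (hord : IsOrdinaryAt W 2) (hf : IsNewformOf W f)
    (hirr : W.HasIrreducibleModPGaloisRep 2) (hm2 : m.Coprime 2) (hmN : m.Coprime N)
    (χ : DirichletCharacter ℚ_[2] m) (hχ : χ.Even) (hsq : χ ^ 2 = 1) :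
    ∃ G G₁ : IwasawaAlgebra 2,
      iwasawaToPowerSeries 2 G = padicLFunctionTame f m (unitRoot W 2 : ℚ_[2]) χ ∧
      iwasawaToPowerSeries 2 G₁ = padicLFunctionTame f m (unitRoot W 2 : ℚ_[2]) (1 : DirichletCharacter ℚ_[2] m) ∧
      PowerSeries.map (PadicInt.toZMod (p := 2)) G = PowerSeries.map (PadicInt.toZMod (p := 2)) G₁ := by
  refine exists_iwasawa_pair_map_toZMod_eq _ _ (fun k ↦ ?_) (fun k ↦ ?_) (fun k ↦ ?_)
  · rw [coeff_padicLFunctionTame]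
    exact norm_padicLCoeffTame_two_le_one hord hf hirr hm2 hmN χ hχ k
  · rw [coeff_padicLFunctionTame]
    exact norm_padicLCoeffTame_two_le_one hord hf hirr hm2 hmN 1 even_one_dirichletCharacter k
  · rw [coeff_padicLFunctionTame, coeff_padicLFunctionTame]
    have h2 : ‖(2 : ℚ_[2])‖ = (2 : ℝ)⁻¹ := by
      have h := Padic.norm_p (p := 2)
      simpa using h
    have h := norm_padicLCoeffTame_sub_one_two_le hord hf hirr hm2 hmN χ hχ hsq k
    rw [h2] at h
    linarith

end Lift

end Literature.NumberTheory.EllipticCurves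

end
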